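import Literature.MathematicalPhysics.QuantumFieldTheory.Balaban1983to89.B8Prop6DentedCubeMemberGaugedPrecompRec
import Literature.MathematicalPhysics.QuantumFieldTheory.Balaban1983to89.B8Prop6DentedCubeMemberNormsFlatGammaPrecompRec
import Literature.MathematicalPhysics.QuantumFieldTheory.Balaban1983to89.B8Prop6DentedCubeMemberFlatScalarGammaGPrecompRec

/-!
# `Balaban1983to89.B8Prop6DentedCubeMemberGaugedRealGammaGPrecompRec` — [Balaban1985RegularSpaces] PROPOSITION 6 (1.135)–(1.138) p. 99 ∕ [Balaban1985Variational]
# (152)–(153) at every dented record cube of print's p. 98 sub-lattice **FOR THE PRE-COMPOSED THEOREM-4 INPUT `(U₀″)^{h}`** (`h` `G`-valued, constant on the block towers under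
# the dented cells, oscillation `ω`), edition γ, with a `G`-valued gauge transformation (joint J-SU; [Balaban1985Averaging] p. 20), record averaging ([Balaban1987RG1] (0.4)) —
# the windows with the letter `ω` and the pre-composed twin of ✓`B8Prop6DentedCubeMemberGaugedRealGammaGRec` §2; item (B′-4)·4 of the plan's road (B′) (pen dag-n05-e g42)

statement-level skeleton of published theorems with citation tags; proofs where landed; nothing here is a claim about the Yang–Mills mass gap

T. Bałaban, *Spaces of regular gauge field configurations on a lattice and gauge fixing conditions*, Commun. Math. Phys. **99** (1985) 75–102 `[Balaban1985RegularSpaces]`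
("[6]"): Prop. 6 (1.135)–(1.138) p. 99, p. 98, (1.130) p. 98, (1.134) p. 99, (1.137) p. 99, Thm 4 p. 88, Prop. 3 p. 87, Prop. 5 pp. 93–94, (1.58)–(1.62) pp. 86–87, (1.31)
p. 82; T. Bałaban, *The variational problem and background fields in renormalization group method for lattice gauge theories*, CMP **102** (1985) 277–309
`[Balaban1985Variational]` ("[15]"): (148)–(153) p. 301; T. Bałaban, *Averaging operations for lattice gauge theories*, CMP **98** (1985) 17–51 `[Balaban1985Averaging]` ("[3]"):
(11) p. 19, p. 20, Prop. 4 p. 38; T. Bałaban, *Propagators for lattice gauge theories in a background field*, CMP **99** (1985) 389–434 `[Balaban1985BackgroundPropagators]` ("[4]"):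
Thms 3.1–3.3 pp. 397–399; [I] = T. Bałaban, *Renormalization group approach to lattice gauge field theories. I*, CMP **109** (1987) 249–301 `[Balaban1987RG1]`: (0.3)–(0.4), (0.6)
pp. 252–253.  STATUS: published, refereed.

CITATION HEADER (lean-in-tree rule).  Cell `pub-ymgap` (HUMAN RULING D-0062, Track A), «N05-REC» road, ROAD (B′) = director-ym №310–№312a branch (ii) case (β) («axiality-
preserving block-constant pre-composition of the Theorem-4 input»; licence line: variant, our proof — NOT a printed clause); LEAD PEN dag-n05-e g42.  WHAT IS REPRODUCED.  §0
`windows136Z_of_small_omega` — the original windows lemma with the letter `ω` (threshold `7dL²Mα₀ + ω ≤ c₁`, `α₁′ = 6dL²Mα₀ + ω`); §1 ★★ `gaugedBoundB8D_dentedMember_precomposed_real_γ_mem`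
— ✓`…GaugedRealGammaGRec.gaugedBoundB8D_dentedMember_real_γ_mem` (chair #10632) VERBATIM with the datum token `U₀″ ↦ (U₀″)^h`, `α₁′ ↦ 6dL²Mα₀ + ω`, the pre-composition binders
of #10822∕#10823, print's threshold `+ ω`, and the pre-composed crown body (F2 §3, ✓p747495) as conclusion; served by F5 ✓`…FlatScalarGammaGPrecompRec`, F4
✓`…NormsFlatGammaPrecompRec` BY NAME.  Consumer: F7 `…ScalarGammaOfNamedFactsGPrecompRec`.  Kind «kernel-checked proof», theorems only: no `def`, no `instance`, no `notation`, no
existing module modified.  `--kind proof --supports stmt-QuantumFields-20541` (K0⁷-keyed, COUNT-NEUTRAL).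

HONEST SCOPE.  Bookkeeping; NO new estimate; the four-line flat socket `SB9`, the three REAL families and `H59D₁` remain DISPLAYED (discharged downstream as in the record chain);
`HThm4Rec*` CONDITIONAL; N05 DISCHARGED OF RECORD since R467 (count-neutral record-level work), N07 NOT discharged; counts unmoved (typed 28∕28 · discharged 8∕28); one finite 𝕋⁴
programme at fixed ε, `G = SU(2)` of record — nothing continuum ∕ ℝ⁴ ∕ OS ∕ mass gap ∕ Clay.  No `sorry`, no `def`.
-/

noncomputable section

open NormedSpace
open Complex (I)

namespace Literature.MathematicalPhysics.QuantumFieldTheory.Balaban1983to89.B8Prop6DentedCubeMemberGaugedRealGammaGPrecompRec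

open MatrixLog B7Prop1Explicit B7Prop2Explicit B7Prop1Local B7AvgGaugeCovariance
open B7Eq92Concrete (mgauge mgauge_one_left)
open B7Prop2Explicit (c2' unitaryUnits)
open B7Prop2Rec (AvgClosedZ C0Z avgClosedZ_unitaryUnits)
open B7Prop3Flat (expCfg c3)
open B7Prop4GeneralLevelsRec (cZ gZ KZ gZ_nonneg)
open B7Prop5Flat (BondIn)
open BlockAveragingZd (avgIterZ ctrShift)
open B7SectCDGaugeAveragesRec (wrecZ)
open B7SectEFLinearisationRec (logCovIterZ)
open B8Ineq130Rec (tlo thi)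
open B8Ineq130 (gaugeAct_one)
open B8Ineq132 (InAk)
open B8Ineq133 (cutCfg_agree)
open B8Ineq133Rec (cutFixedZ avgIterZ_eq_of_agree)
open B8Eq115GaugeFixing (gaugeAct_mul gaugeAct_agree gaugeAct_mem_of)
open B8Eq115GaugeFixingRec (localGaugeZ towerGaugeZ)
open B8Eq119TwistedAxialRec (InAxZ Restr129Z UnderZ)
open B8Eq131DerivationRec (eq87_of_inAxZ_restr129Z)
open B8Eq146AExpansion (iEta)
open B8Eq184Proof (cfgExp)
open B8Eq140Level (SideTouches sideTouches_of_bondTouches)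
open B8Eq138LandauZd (logCfg covLap)
open B8Eq138LandauZdRec (IsLandau138WZ)
open B8Eq131Cubes (tLo tHi ctr)
open B8Eq131CubesRec (bLoZ bHiZ tLo_eq tHi_eq le_of_margin_mono)
open B8Lemma1NonAbelian (mulCfg)
open B8Prop6OfThm4 (const_136)
open B8LeafModelZd3 (mlogCfg mlogCfg_spec)
open B8Prop6CubeMemberEq137Rec (logCovIter_one_eq_mlog_avgIter_loc_of_window inBox_sq_top_of_bond mem_cubeZ_top_of_bondBox under_or_under_of_inBox_bondBoxZ)
open B8DentedCubeMemberZdRec (lamST_top_apply)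
open Node00 (CubeB8DZ GaugedBoundB8DZ)
open scoped Matrix
open MatrixLog B7Prop1Explicit B7Prop2Explicit B7Prop1Local B7Eq92Concrete
open B7Prop2Explicit (c2' c2'_pos)
open B7Prop2Rec (C0Z C0Z_pos)
open B7Prop3Flat (c3)
open B7SectEFLinearisationRec (linCovIterZ)
open B8Ineq132 (covDerivFwd InAk BondTouches)
open B8Ineq133Rec (cutFixedZ)
open B8Eq115GaugeFixingRec (localGaugeZ)
open B8Eq119TwistedAxialRec (Restr129Z flmZ)
open B8Eq140Level (SideTouches)
open B8Eq143PlaqExpansion (pdiv)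
open B8Eq146AExpansion (iEta plaqCovDeriv)
open B8Eq155JBound (Jcur wsup)
open B8ScaledSupNorm (bondNorm msup)
open B8Eq138LandauZd (covLap logCfg)
open B8LambdaSpaceKLevel (wt)
open B8Prop6OfThm4 (const_136 smallness_134)
open B8Prop6CubeMemberNorms (ineq161_of_small)
open B8Prop6DentedCubeMemberNormsGammaRec (prop3_windowsZ)
open B8Prop6DentedCubeMemberNormsFlatGammaPrecompRec (norms136_dentedMember_precomposed_flat_γ_d4)
open B8Prop6DentedCubeMemberFlatScalarGammaGPrecompRec (prop6_dentedMember_precomposed_flat_of_real_γ_mem)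
open B9SupplySockB9P3ZdBeta (CrossB)
open B8Real123FlatTranslateRec (Real123Block)
open B8Eq184Proof (gaugeExp)
open B7Prop1Explicit (expUnit)
open MatrixLog (mlog)
open B8Prop6DentedCubeMemberGaugedRealGammaRec (windows136Z_of_small)
open B8Prop6DentedCubeMemberGaugedPrecompRec (gaugedBoundB8DZBody_of_clauses_precomposed_mem)
open B7AvgGaugeCovariance (uLev)
open B8Eq119TwistedAxialRec (UnderZ)

export B7Prop1Explicit (Site)

variable {d : ℕ}

/-! ## §0 The windows from ONE threshold, with the oscillation letter `ω` -/

section Windows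

/-- (ω-EDITION of ✓`B8Prop6DentedCubeMemberGaugedRealGammaRec.windows136Z_of_small`.) **EVERY WINDOW FROM ONE THRESHOLD, WITH THE OSCILLATION LETTER `ω`** (bookkeeping
for «α₀, α₁, α₂ bounded by a constant depending on d and L only», p. 87, and «let 7dL²Mα₀ ≤ c₁», p. 99, at the pre-composed input): for `d, L ≥ 2`, `B₀ > 0`, `C₂ ≥ 0` and a
Proposition-3 threshold `c > 0` there is `c₁ > 0` such that `7dL²Mα₀ + ω ≤ c₁` (`0 ≤ ω`) and `L ≤ dM` give, with `(α₀′, α₁′) = (L³α₀, 6dL²Mα₀ + ω)`, `t = α₀′ + α₁′`,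
`α₂ = 5dLB₀·t`: the (1.130)-regime, `α₀′, α₁′, α₂ ≤ c`, (1.61) (`ineq161_of_small`), the [3]-Prop.-4 ∕ Prop.-3 windows at `(α₀′, α₂)` (`prop3_windowsZ`), `dLα₁′ ≤ 1∕8` and
`dMα₀ ≤ 1∕2` — the `ω`-free members read off the original at `7dL²Mα₀ ≤ c₁`. [cite: Balaban1985RegularSpaces, Prop. 3 p.87, (1.61) p.86, Prop. 6 p.99, (1.130) p.98] -/
theorem windows136Z_of_small_omega (hd2 : 2 ≤ d) {L : ℕ} (hL : 2 ≤ L) {B₀ C₂ c : ℝ} (hB₀ : 0 < B₀) (hC₂ : 0 ≤ C₂) (hc : 0 < c) :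
    ∃ c₁ : ℝ, 0 < c₁ ∧ ∀ (M ρ : ℕ), 1 ≤ M → ρ ≤ M → 11 * (d : ℝ) < M → (L : ℝ) ≤ d * M → ∀ (α₀ : ℝ), 0 < α₀ → ∀ (ω : ℝ), 0 ≤ ω →
      7 * d * (L : ℝ) ^ 2 * M * α₀ + ω ≤ c₁ →
      (C0Z d * (α₀ * (L : ℝ) ^ 2) ≤ 1 / 3 ∧ 2 * (α₀ * (L : ℝ) ^ 2) ≤ c2' d L ∧
        11 * (d : ℝ) ^ 2 * (L : ℝ) ^ 2 * α₀ + ((M : ℝ) + 4 * ρ) * d * (L : ℝ) ^ 2 * α₀ ≤ 1 / 6) ∧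
      ((L : ℝ) ^ 3 * α₀ ≤ c ∧ (6 * d * (L : ℝ) ^ 2 * M * α₀ + ω) ≤ c ∧
        5 * (d : ℝ) * L * B₀ * ((L : ℝ) ^ 3 * α₀ + (6 * d * (L : ℝ) ^ 2 * M * α₀ + ω)) ≤ c) ∧
      2 * (5 * (d : ℝ) * L * B₀ * ((L : ℝ) ^ 3 * α₀ + (6 * d * (L : ℝ) ^ 2 * M * α₀ + ω))) ^ 2
        + 20 * d * ((L : ℝ) ^ 3 * α₀) * (5 * (d : ℝ) * L * B₀ * ((L : ℝ) ^ 3 * α₀ + (6 * d * (L : ℝ) ^ 2 * M * α₀ + ω)))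
        + 2 * C₂ * (5 * (d : ℝ) * L * B₀ * ((L : ℝ) ^ 3 * α₀ + (6 * d * (L : ℝ) ^ 2 * M * α₀ + ω))) ^ 2
        ≤ (L : ℝ) ^ 3 * α₀ + (6 * d * (L : ℝ) ^ 2 * M * α₀ + ω) ∧
      (C0Z d * ((L : ℝ) ^ 3 * α₀) ≤ 1 / 3 ∧ 4 * ((L : ℝ) ^ 3 * α₀) ≤ c2' d L ∧
        16 * (5 * (d : ℝ) * L * B₀ * ((L : ℝ) ^ 3 * α₀ + (6 * d * (L : ℝ) ^ 2 * M * α₀ + ω))) ≤ 1 ∧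
        Real.exp (4 * cZ d * ((L : ℝ) ^ 3 * α₀))
          * (1 + 2 * (131072 * ((d : ℝ) + 1) ^ 2) * (KZ d L) ^ 2 * (5 * (d : ℝ) * L * B₀ * ((L : ℝ) ^ 3 * α₀ + (6 * d * (L : ℝ) ^ 2 * M * α₀ + ω)))) ≤ 2 ∧
        KZ d L * (5 * (d : ℝ) * L * B₀ * ((L : ℝ) ^ 3 * α₀ + (6 * d * (L : ℝ) ^ 2 * M * α₀ + ω))) ≤ c3 d L ∧
        (d : ℝ) * L * ((6 * d * (L : ℝ) ^ 2 * M * α₀ + ω)) ≤ 1 / 8) ∧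
      (d : ℝ) * M * α₀ ≤ 1 / 2 := by
  have hL1 : 1 ≤ L := le_trans (by norm_num) hL
  have hd1 : 1 ≤ d := le_trans (by norm_num) hd2
  have hLpos : (0 : ℝ) < L := by exact_mod_cast hL1
  have hdpos : (0 : ℝ) < d := by exact_mod_cast hd1
  obtain ⟨c₀, hc₀, hwin₀⟩ := windows136Z_of_small hd2 hL hB₀ hC₂ hc
  obtain ⟨cw, hcw, hwin⟩ := prop3_windowsZ (d := d) hd1 hL1 hB₀.le
  set B : ℝ := 5 * (d : ℝ) * L * B₀ with hB
  have hBpos : 0 < B := by positivity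
  set K : ℝ := (2 + 2 * C₂) * B ^ 2 + 20 * d * B with hK
  have hKpos : 0 < K := by positivity
  refine ⟨min c₀ (min c (min (c / B) (min cw (min (cw / B) (min (1 / K) (1 / (8 * d * L))))))), ?_, ?_⟩
  · exact lt_min hc₀ (lt_min hc (lt_min (by positivity) (lt_min hcw (lt_min (by positivity) (lt_min (by positivity) (by positivity))))))
  intro M ρ hM1 hρM hM hLdM α₀ hα ω hω hs
  simp only [le_min_iff] at hs
  obtain ⟨hs_0, hs_c, hs_cB, hs_w, hs_wB, hs_K, hs_8⟩ := hs
  have hMpos : (0 : ℝ) < M := by exact_mod_cast lt_of_lt_of_le (by norm_num) hM1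
  -- the `ω`-free windows (regime, the `α₀′`-windows, `dMα₀ ≤ 1∕2`) from the original at `7dL²Mα₀ ≤ c₀`
  have hs0 : 7 * d * (L : ℝ) ^ 2 * M * α₀ ≤ c₀ := by linarith
  obtain ⟨hreg, -, -, ⟨hα3', hα4', -, -, -, -⟩, h12⟩ := hwin₀ M ρ hM1 hρM hM hLdM α₀ hα hs0
  set s : ℝ := 7 * d * (L : ℝ) ^ 2 * M * α₀ + ω with hs_def
  set t : ℝ := (L : ℝ) ^ 3 * α₀ + (6 * d * (L : ℝ) ^ 2 * M * α₀ + ω) with ht_def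
  have hα₀' : 0 < (L : ℝ) ^ 3 * α₀ := by positivity
  have hα₁' : 0 < 6 * d * (L : ℝ) ^ 2 * M * α₀ + ω := by positivity
  have hts : t ≤ s := by
    have h0 := (B8.prop6_smallness_iff (d := (d : ℝ)) (M := (M : ℝ)) hLpos hα).2 hLdM
    rw [ht_def, hs_def]; linarith
  have h0t : (L : ℝ) ^ 3 * α₀ ≤ t := by rw [ht_def]; linarith
  have h1t : 6 * d * (L : ℝ) ^ 2 * M * α₀ + ω ≤ t := by rw [ht_def]; linarith
  have htpos : 0 < t := by positivity
  have hBt : B * t ≤ B * s := mul_le_mul_of_nonneg_left hts hBpos.le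
  have hBs_c : B * s ≤ c := by
    have := mul_le_mul_of_nonneg_left hs_cB hBpos.le
    rwa [mul_div_cancel₀ _ hBpos.ne'] at this
  have hBs_w : B * s ≤ cw := by
    have := mul_le_mul_of_nonneg_left hs_wB hBpos.le
    rwa [mul_div_cancel₀ _ hBpos.ne'] at this
  -- (1.61) at `t`
  have hKt : K * t ≤ 1 := by
    calc K * t ≤ K * s := mul_le_mul_of_nonneg_left hts hKpos.le
      _ ≤ K * (1 / K) := mul_le_mul_of_nonneg_left hs_K hKpos.le
      _ = 1 := by field_simp
  have h61 := ineq161_of_small (C₂ := C₂) hdpos.le h0t htpos.le hBpos.le hKt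
  -- the Prop.-3 / [3]-Prop.-4 windows at `(α₀′, α₂ = B·t)`
  obtain ⟨-, -, h16, -, hsm, hc₃, -, -, -⟩ :=
    hwin ((L : ℝ) ^ 3 * α₀) (B * t) hα₀' (h0t.trans (hts.trans hs_w)) (by positivity) (hBt.trans hBs_w)
  -- `dLα₁′ ≤ 1/8`
  have h8 : (d : ℝ) * L * (6 * d * (L : ℝ) ^ 2 * M * α₀ + ω) ≤ 1 / 8 := by
    have hdL : (0 : ℝ) < d * L := by positivity
    calc (d : ℝ) * L * (6 * d * (L : ℝ) ^ 2 * M * α₀ + ω) ≤ (d * L) * s := mul_le_mul_of_nonneg_left (h1t.trans hts) hdL.le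
      _ ≤ (d * L) * (1 / (8 * d * L)) := mul_le_mul_of_nonneg_left hs_8 hdL.le
      _ = 1 / 8 := by field_simp
  exact ⟨hreg, ⟨h0t.trans (hts.trans hs_c), h1t.trans (hts.trans hs_c), hBt.trans hBs_c⟩, h61,
    ⟨hα3', hα4', h16, hsm, hc₃, h8⟩, h12⟩

end Windows

/-! ## §1 The pre-composed crown body at every dented record cube from the flat γ inputs, `G`-valued fields and gauge transformations -/

section Real

variable {𝔸 : Type} [CStarAlgebra 𝔸] [Nontrivial 𝔸]

set_option maxHeartbeats 400000 in
open Classical in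
/-- ★★ (PRE-COMPOSED twin of ✓`B8Prop6DentedCubeMemberGaugedRealGammaGRec.gaugedBoundB8D_dentedMember_real_γ_mem`.) **PROPOSITION 6 (p. 99), (1.135)–(1.138) ∕ [15] (152)–(153)
AT EVERY DENTED RECORD CUBE FOR THE PRE-COMPOSED THEOREM-4 INPUT `(U₀″)^{h}`, WITH A `G`-VALUED GAUGE TRANSFORMATION, FROM THE FLAT FOUR-LINE PROP.-3-FRAME γ SOCKET, THREE REAL
INEQUALITY FAMILIES AND THEOREM 4's (1.59) CLAUSE AT BACKGROUND `1`** ([Balaban1985Averaging] p. 20).  The original VERBATIM (joint J-SU data; the four-line socket `SB9`; the three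
REAL families; `H59D₁`) with: the pre-composition binders of (B′-4)·2∕·3 (`h` `G`-valued, constant `= X(j, y)` on the block tower under every dented cell; `ω ≥ 0`, the oscillation
of `h` across the (1.35) bonds and the level-0 collar) after `InAk`; print's threshold `7dL²Mα₀ + ω ≤ c₁` (⇒ Theorem 4's `L³α₀ + (6dL²Mα₀ + ω) ≤ c₁` since `L ≤ dM`); the (1.59)
clause's datum `(U₀″)^h` and `α₁′ = 6dL²Mα₀ + ω`; and the CONCLUSION = the PRE-COMPOSED CROWN BODY (F2 §3): `Node00.GaugedBoundB8DZ`'s twelve clauses read at the transformation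
`h⁻¹·u` with `r = 5dLB₀·(7dL²Mα₀ + ω)`, clause 3 (1.29) EXACT for `u`, clause 11 for the pre-composed axial representative.  Served by F5 `prop6_dentedMember_precomposed_flat_of_real_γ_mem`,
F4 `norms136_dentedMember_precomposed_flat_γ_d4`, §0 `windows136Z_of_small_omega` and F2 §3 `gaugedBoundB8DZBody_of_clauses_precomposed_mem` BY NAME.  Item (B′-4)·4 of the
plan's road (B′) (director-ym №310–№312a branch (ii) case (β); licence: variant, our proof).
[cite: Balaban1985RegularSpaces, Prop. 6 (1.135)–(1.138) p.99, Thm 4 p.88, Prop. 3 p.87, Prop. 5 pp.93–94, (1.58)–(1.59) p.86, (1.31) p.82; Balaban1985Variational, (148)–(153) p.301; Balaban1985Averaging, p.20, (11) p.19; Balaban1985BackgroundPropagators, Thms 3.1–3.3 pp.397–399; Balaban1987RG1, (0.3)–(0.4) pp.252–253, (0.6) p.253] -/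
theorem gaugedBoundB8D_dentedMember_precomposed_real_γ_mem (τ : 𝔸 →L[ℂ] ℂ) (hτ : ∀ x y : 𝔸, τ (x * y) = τ (y * x)) (hd2 : 2 ≤ d) {L sL : ℕ} (hLs : L = 2 * sL + 1)
    (hs1 : 1 ≤ sL)
    {G H : Subgroup 𝔸ˣ} (hGrp2 : ∀ g ∈ H, ‖(g : 𝔸) - 1‖ ≤ 1 / 8 → τ (mlog (g : 𝔸)) = 0) (hGrp3 : ∀ S : 𝔸, τ S = 0 → expUnit S ∈ H)
    (hGA : AvgClosedZ d L G) (hGH : G ≤ H) (hGu : G ≤ unitaryUnits 𝔸)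
    (hexpG : ∀ lam : Site d → 𝔸, (∀ x, IsSelfAdjoint (lam x)) → (∀ x, τ (lam x) = 0) → ∀ x, gaugeExp lam x ∈ G)
    {B₀ B₀' C₂ cB9 B₀'H B₂' BG BR Bbd : ℝ} (hB₀ : 0 < B₀)
    (hB₀' : 0 < B₀') (hB : 2 ≤ 5 * (d : ℝ) * L * B₀) (hC₂ : 2 * ((1 + 2 * gZ d L) * (2 * (131072 * ((d : ℝ) + 1) ^ 2) * (KZ d L) ^ 2)) * (L : ℝ) ^ 2 ≤ C₂) (hcB9 : 0 < cB9)
    (hB₀'H : 0 < B₀'H) (hB₂' : 0 ≤ B₂') (hBG : 0 ≤ BG) (hBR : 0 ≤ BR) (hfree : 3 * (2 * (d : ℝ) * (L : ℝ) ^ 2) * BG * BR ≤ B₀')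
    (hBbd : 0 ≤ Bbd) (hBd : 4 * Bbd ≤ ((d : ℝ) * L - 1) * B₀) :
    ∃ c₁ : ℝ, 0 < c₁ ∧ ∀ (η : ℝ), 0 < η → ∀ {K : ℕ} {Ω : ℕ → Set (Site d)} (c : CubeB8DZ d L K Ω),
      -- (1.59) for `G(1)`, `H(1)` IN THE REPAIRED CURRENCY: the FOUR-LINE Prop.-3-frame socket at background `1` on the cube, collar term on each line
      (∀ α₀' α₂ : ℝ, 0 < α₀' → α₀' ≤ cB9 → 0 < α₂ → α₂ ≤ cB9 →
        ∀ (W : Site d → Fin d → 𝔸ˣ), (∀ x κ, W x κ ∈ unitaryUnits 𝔸) →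
        InAk L c.k η α₀' c.sq (1 : Site d → Fin d → 𝔸ˣ) → InAk L c.k η α₀' c.sq (mulCfg W (1 : Site d → Fin d → 𝔸ˣ)) →
        IsLandau138WZ L c.k η (c.sq 0) c.lamS (1 : Site d → Fin d → 𝔸ˣ) W →
        ∀ A' : Site d → Fin d → 𝔸, (∀ y τ, IsSelfAdjoint (A' y τ)) →
        (∀ j, j ≤ c.k → ∀ (y : Site d) (τ : Fin d), SideTouches (c.sq j) y τ →
          W y τ = cfgExp η A' y τ ∧ ‖A' y τ‖ ≤ α₂ * ((L : ℝ) ^ j * η)⁻¹) →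
        (∀ (y : Site d) (τ : Fin d), (∀ j, j ≤ c.k → ¬ SideTouches (c.sq j) y τ) → A' y τ = 0) →
        msup L c.k η (-(1 : ℝ)) (fun j (b : Site d × Fin d) => SideTouches (c.sq j) b.1 b.2) (fun b => A' b.1 b.2)
            ≤ B₀ * (bondNorm L c.k η (-(3 : ℝ)) c.sq (fun x μ => Jcur η (1 : Site d → Fin d → 𝔸ˣ) A' μ x)
              + wsup 1 (fun p : {p : ℕ × (Site d × Fin d) // p.1 ≤ c.k ∧ (p.2 ∈ c.lamBPT c.k p.1 ∨ (p.1 = 0 ∧ CrossB (c.sq 0) p.2))} =>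
                  linCovIterZ L (1 : Site d → Fin d → 𝔸ˣ) (iEta η A') p.1.1 p.1.2.1 p.1.2.2))
              + Bbd * msup L c.k η (-(1 : ℝ)) (fun j (b : Site d × Fin d) => j = 0 ∧ SideTouches (c.sq 0) b.1 b.2 ∧
                  ¬ BondTouches (c.sq 0) b.1 b.2) (fun b => A' b.1 b.2) ∧
          msup L c.k η (-(2 : ℝ)) (fun j (t : Fin d × Fin d × Site d) => SideTouches (c.sq j) t.2.2 t.2.1)
              (fun t => covDerivFwd η (1 : Site d → Fin d → 𝔸ˣ) t.1 (fun z => A' z t.2.1) t.2.2)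
            ≤ B₀ * (bondNorm L c.k η (-(3 : ℝ)) c.sq (fun x μ => Jcur η (1 : Site d → Fin d → 𝔸ˣ) A' μ x)
              + wsup 1 (fun p : {p : ℕ × (Site d × Fin d) // p.1 ≤ c.k ∧ (p.2 ∈ c.lamBPT c.k p.1 ∨ (p.1 = 0 ∧ CrossB (c.sq 0) p.2))} =>
                  linCovIterZ L (1 : Site d → Fin d → 𝔸ˣ) (iEta η A') p.1.1 p.1.2.1 p.1.2.2))
              + Bbd * msup L c.k η (-(1 : ℝ)) (fun j (b : Site d × Fin d) => j = 0 ∧ SideTouches (c.sq 0) b.1 b.2 ∧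
                  ¬ BondTouches (c.sq 0) b.1 b.2) (fun b => A' b.1 b.2) ∧
          bondNorm L c.k η (-(3 : ℝ)) c.sq (fun x μ => pdiv η (1 : Site d → Fin d → 𝔸ˣ) (plaqCovDeriv η (1 : Site d → Fin d → 𝔸ˣ) A') μ x)
            ≤ B₀ * (bondNorm L c.k η (-(3 : ℝ)) c.sq (fun x μ => Jcur η (1 : Site d → Fin d → 𝔸ˣ) A' μ x)
              + wsup 1 (fun p : {p : ℕ × (Site d × Fin d) // p.1 ≤ c.k ∧ (p.2 ∈ c.lamBPT c.k p.1 ∨ (p.1 = 0 ∧ CrossB (c.sq 0) p.2))} =>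
                  linCovIterZ L (1 : Site d → Fin d → 𝔸ˣ) (iEta η A') p.1.1 p.1.2.1 p.1.2.2))
              + Bbd * msup L c.k η (-(1 : ℝ)) (fun j (b : Site d × Fin d) => j = 0 ∧ SideTouches (c.sq 0) b.1 b.2 ∧
                  ¬ BondTouches (c.sq 0) b.1 b.2) (fun b => A' b.1 b.2) ∧
          bondNorm L c.k η (-(3 : ℝ)) c.sq (fun x μ => covLap η (1 : Site d → Fin d → 𝔸ˣ) (fun z => A' z μ) x)
            ≤ B₀ * (bondNorm L c.k η (-(3 : ℝ)) c.sq (fun x μ => Jcur η (1 : Site d → Fin d → 𝔸ˣ) A' μ x)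
              + wsup 1 (fun p : {p : ℕ × (Site d × Fin d) // p.1 ≤ c.k ∧ (p.2 ∈ c.lamBPT c.k p.1 ∨ (p.1 = 0 ∧ CrossB (c.sq 0) p.2))} =>
                  linCovIterZ L (1 : Site d → Fin d → 𝔸ˣ) (iEta η A') p.1.1 p.1.2.1 p.1.2.2))
              + Bbd * msup L c.k η (-(1 : ℝ)) (fun j (b : Site d × Fin d) => j = 0 ∧ SideTouches (c.sq 0) b.1 b.2 ∧
                  ¬ BondTouches (c.sq 0) b.1 b.2) (fun b => A' b.1 b.2)) →
      ∀ (U₀ : Site d → Fin d → 𝔸ˣ), (∀ x κ, U₀ x κ ∈ G) → ∀ (α₀ : ℝ), 0 < α₀ → InAk L K η α₀ Ω U₀ →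
      -- the pre-composition `h`: `G`-valued, constant `= X(j, y)` on the block tower under every dented cell, oscillation `ω`
      ∀ (h : Site d → 𝔸ˣ), (∀ x, h x ∈ G) → ∀ (X : ℕ → Site d → 𝔸ˣ),
      (∀ j, 1 ≤ j → j ≤ c.k → ∀ y ∈ c.lamS j, ∀ x, UnderZ L j y x → h x = X j y) → ∀ (ω : ℝ), 0 ≤ ω →
      (∀ j, j ≤ c.k → ∀ (z : Site d) (μ : Fin d),
        (∀ x, InBox (fun i => (L : ℤ) ^ j * z i - (ctrShift L j : ℤ)) (fun i => (L : ℤ) ^ j * z i + (ctrShift L j : ℤ) + if i = μ then (L : ℤ) ^ j else 0) x →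
          x ∈ c.sq (j - 1)) → ‖((uLev L h j z : 𝔸ˣ) : 𝔸) - ((uLev L h j (z + e μ) : 𝔸ˣ) : 𝔸)‖ ≤ ω) →
      (∀ b ∈ {b : Site d × Fin d | SideTouches (c.sq 0) b.1 b.2}, ‖((h b.1 : 𝔸ˣ) : 𝔸) - ((h (b.1 + e b.2) : 𝔸ˣ) : 𝔸)‖ ≤ ω) →
      7 * d * (L : ℝ) ^ 2 * c.M * α₀ + ω ≤ c₁ →
      -- the weights of `Q′ᵀwQ′` and THE THREE REAL INEQUALITY FAMILIES at every truncation `n ≤ k`, CENTRED labels (`Real123Block`)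
      ∀ (w : ℕ → ℝ), (∀ j, 0 ≤ w j) →
      (∀ n, 1 ≤ n → n ≤ c.k → Real123Block L (flmZ L) η n w c.sq (c.lamST n) BG B₀'H B₂' BR) →
      -- (1.59) for `G(1)` IN THE REPAIRED CURRENCY: Theorem 4's two-member clause at background `1`, support clause + collar allowance (`H59D₁`)
      ((∀ m, 1 ≤ m → m ≤ c.k → ∀ (u : Site d → 𝔸ˣ) (W : Site d → Fin d → 𝔸ˣ) (A' : Site d → Fin d → 𝔸),
        (∀ x, u x ∈ unitaryUnits 𝔸) → (∀ x, x ∉ c.sq 0 → u x = 1) →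
          mgauge (1 : Site d → Fin d → 𝔸ˣ) u W = (gaugeAct h (cutFixedZ L (tLo c.a c.ρ) (tHi c.a c.M c.ρ) U₀ c.k (ctr c.a c.M))) →
          Restr129Z L m (c.lamST m) (1 : Site d → Fin d → 𝔸ˣ) u →
          IsLandau138WZ L m η (c.sq 0) (c.lamST m) (1 : Site d → Fin d → 𝔸ˣ) W →
        (∀ y τ, IsSelfAdjoint (A' y τ)) →
        (∀ j, j ≤ m → ∀ y τ, SideTouches (c.sq j) y τ →
        W y τ = cfgExp η A' y τ ∧
          ‖A' y τ‖ ≤ (2 * (L * (5 * (d : ℝ) * L * B₀ * (((L : ℝ) ^ 3 * α₀) + ((6 * d * (L : ℝ) ^ 2 * c.M * α₀ + ω))))) + 8 * (8 * B₀' * (5 * (d : ℝ) * L * B₀) * (((L : ℝ) ^ 3 * α₀) + ((6 * d * (L : ℝ) ^ 2 * c.M * α₀ + ω))))) * ((L : ℝ) ^ j * η)⁻¹) →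
        (∀ y τ, (∀ j, j ≤ m → ¬ SideTouches (c.sq j) y τ) → A' y τ = 0) →
        msup L m η (-(1 : ℝ)) (fun j (b : Site d × Fin d) => SideTouches (c.sq j) b.1 b.2) (fun b => A' b.1 b.2)
        ≤ B₀ * (bondNorm L m η (-(3 : ℝ)) c.sq (fun x μ => Jcur η (1 : Site d → Fin d → 𝔸ˣ) A' μ x)
        + wsup 1 (fun p : {p : ℕ × (Site d × Fin d) // p.1 ≤ m ∧ (p.2 ∈ c.lamBPT m p.1 ∨ (p.1 = 0 ∧ CrossB (c.sq 0) p.2))} =>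
        linCovIterZ L (1 : Site d → Fin d → 𝔸ˣ) (iEta η A') p.1.1 p.1.2.1 p.1.2.2))
        + Bbd * msup L m η (-(1 : ℝ)) (fun j (b : Site d × Fin d) => j = 0 ∧ SideTouches (c.sq 0) b.1 b.2 ∧
            ¬ BondTouches (c.sq 0) b.1 b.2) (fun b => A' b.1 b.2) ∧
        msup L m η (-(2 : ℝ)) (fun j (t : Fin d × Fin d × Site d) => SideTouches (c.sq j) t.2.2 t.2.1)
        (fun t => covDerivFwd η (1 : Site d → Fin d → 𝔸ˣ) t.1 (fun z => A' z t.2.1) t.2.2)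
        ≤ B₀ * (bondNorm L m η (-(3 : ℝ)) c.sq (fun x μ => Jcur η (1 : Site d → Fin d → 𝔸ˣ) A' μ x)
        + wsup 1 (fun p : {p : ℕ × (Site d × Fin d) // p.1 ≤ m ∧ (p.2 ∈ c.lamBPT m p.1 ∨ (p.1 = 0 ∧ CrossB (c.sq 0) p.2))} =>
        linCovIterZ L (1 : Site d → Fin d → 𝔸ˣ) (iEta η A') p.1.1 p.1.2.1 p.1.2.2))
        + Bbd * msup L m η (-(1 : ℝ)) (fun j (b : Site d × Fin d) => j = 0 ∧ SideTouches (c.sq 0) b.1 b.2 ∧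
            ¬ BondTouches (c.sq 0) b.1 b.2) (fun b => A' b.1 b.2))) →
      ∃ u : Site d → 𝔸ˣ, (∀ x, u x ∈ G) ∧ (∀ x, x ∉ c.sq 0 → u x = 1) ∧
        Restr129Z L c.k c.lamS (1 : Site d → Fin d → 𝔸ˣ) u ∧
        IsLandau138WZ L c.k η (c.sq 0) c.lamS (1 : Site d → Fin d → 𝔸ˣ) (c.fixed U₀ (h⁻¹ * u)) ∧
        (∀ j, j ≤ c.k → ∀ b ∈ {b : Site d × Fin d | SideTouches (c.sq j) b.1 b.2},
          c.fixed U₀ (h⁻¹ * u) b.1 b.2 = cfgExp η (logCfg η (c.fixed U₀ (h⁻¹ * u))) b.1 b.2 ∧ IsSelfAdjoint (logCfg η (c.fixed U₀ (h⁻¹ * u)) b.1 b.2) ∧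
            ‖logCfg η (c.fixed U₀ (h⁻¹ * u)) b.1 b.2‖ ≤ (5 * (d : ℝ) * L * B₀ * (7 * d * (L : ℝ) ^ 2 * c.M * α₀ + ω)) * ((L : ℝ) ^ j * η)⁻¹) ∧
        (∀ x, ((c.vfix U₀)⁻¹ * (h⁻¹ * u)) x ∈ G) ∧
        AgreeOn (tlo L (tLo c.a c.ρ) c.k) (thi L (tHi c.a c.M c.ρ) c.k) (gaugeAct ((c.vfix U₀)⁻¹ * (h⁻¹ * u))⁻¹ U₀) (c.fixed U₀ (h⁻¹ * u)) ∧
        msup L c.k η (-(2 : ℝ)) (fun j (t : Fin d × Fin d × Site d) => SideTouches (c.sq j) t.2.2 t.2.1)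
            (fun t => covDerivFwd η (1 : Site d → Fin d → 𝔸ˣ) t.1 (fun z => c.expo η U₀ (h⁻¹ * u) z t.2.1) t.2.2) ≤ (5 * (d : ℝ) * L * B₀ * (7 * d * (L : ℝ) ^ 2 * c.M * α₀ + ω)) ∧
        bondNorm L c.k η (-(3 : ℝ)) c.sq
            (fun x μ => pdiv η (1 : Site d → Fin d → 𝔸ˣ) (plaqCovDeriv η (1 : Site d → Fin d → 𝔸ˣ) (c.expo η U₀ (h⁻¹ * u))) μ x) ≤ (5 * (d : ℝ) * L * B₀ * (7 * d * (L : ℝ) ^ 2 * c.M * α₀ + ω)) ∧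
        bondNorm L c.k η (-(3 : ℝ)) c.sq (fun x μ => covLap η (1 : Site d → Fin d → 𝔸ˣ) (fun z => c.expo η U₀ (h⁻¹ * u) z μ) x) ≤ (5 * (d : ℝ) * L * B₀ * (7 * d * (L : ℝ) ^ 2 * c.M * α₀ + ω)) ∧
        (∀ (x : Site d) (μ : Fin d), bLoZ L c.a 0 0 ≤ x → x + e μ ≤ bHiZ L c.a c.M 0 0 → c.inTop x → c.inTop (x + e μ) →
          logCovIterZ L (1 : Site d → Fin d → 𝔸ˣ) (iEta η (c.expo η U₀ (h⁻¹ * u))) c.k x μ = mlog ((avgIterZ L (gaugeAct h (c.axial U₀)) c.k x μ : 𝔸ˣ) : 𝔸)) := by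
  have hL1 : 1 ≤ L := by omega
  have hL : 2 ≤ L := by omega
  have hd1 : 1 ≤ d := le_trans (by norm_num) hd2
  have hLpos : (0 : ℝ) < L := by exact_mod_cast hL1
  have hdpos : (0 : ℝ) < d := by exact_mod_cast hd1
  have hgZ := gZ_nonneg d L
  have hC₂0 : 0 ≤ C₂ := le_trans (by positivity) hC₂
  obtain ⟨c₄, hc₄, H4⟩ := prop6_dentedMember_precomposed_flat_of_real_γ_mem (𝔸 := 𝔸) τ hτ hd2 hLs hs1 hGrp2 hGrp3 hGA hGH hGu hexpG hB₀ hB₀' hB hB₀'H hB₂'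
    hBG hBR hfree hBbd hBd
  obtain ⟨c₃, hc₃, N3⟩ := norms136_dentedMember_precomposed_flat_γ_d4 (𝔸 := 𝔸) hd2 hLs hs1 hB₀ hC₂ hcB9 hBbd hBd
  obtain ⟨cW, hcW, W⟩ := windows136Z_of_small_omega hd2 hL hB₀ hC₂0 hc₃
  set B : ℝ := 5 * (d : ℝ) * L * B₀ with hB_def
  have hB0 : 0 < B := by positivity
  have hKZ2 : (2 : ℝ) ≤ KZ d L := by have h := gZ_nonneg d L; show (2 : ℝ) ≤ 2 * (1 + 2 * gZ d L); linarith only [h]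
  have hKZ0 : 0 < KZ d L := by linarith only [hKZ2]
  set C : ℝ := 131072 * ((d : ℝ) + 1) ^ 2 * (KZ d L) ^ 2 with hC_def
  have hC0 : 0 < C := by positivity
  refine ⟨min c₄ (min cW (1 / (16 * C * B))), lt_min hc₄ (lt_min hcW (by positivity)), ?_⟩
  intro η hη K Ω c SB9 U₀ hU₀G α₀ hα hAK h hhG X hconst ω hω hoscj hosc0 hs w hw REAL H59
  have hU₀ : ∀ x κ, U₀ x κ ∈ unitaryUnits 𝔸 := fun x κ => hGu (hU₀G x κ)
  have hh : ∀ x, h x ∈ unitaryUnits 𝔸 := fun x => hGu (hhG x)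
  -- the cube's laws as datum binders
  have hk : 1 ≤ c.k := c.one_le_k
  have hρL : L ≤ c.ρ := c.L_le_ρ
  have hρM : c.ρ ≤ c.M := c.ρ_le_M
  have hρ : 1 ≤ c.ρ := hL1.trans hρL
  have hM1 : 1 ≤ c.M := hρ.trans hρM
  have hM : 11 * (d : ℝ) < c.M := by exact_mod_cast c.big
  have hLdM : (L : ℝ) ≤ d * c.M := by exact_mod_cast c.L_le_dM
  have hMpos : (0 : ℝ) < c.M := by exact_mod_cast hM1
  have hA : InAk L c.k η α₀ Ω U₀ := c.inAk hAK
  have hs₄ : 7 * d * (L : ℝ) ^ 2 * c.M * α₀ + ω ≤ c₄ := hs.trans (min_le_left _ _)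
  have hsW : 7 * d * (L : ℝ) ^ 2 * c.M * α₀ + ω ≤ cW := hs.trans ((min_le_right _ _).trans (min_le_left _ _))
  have hsC : 7 * d * (L : ℝ) ^ 2 * c.M * α₀ + ω ≤ 1 / (16 * C * B) := hs.trans ((min_le_right _ _).trans (min_le_right _ _))
  -- «7dL²Mα₀ + ω ≤ c₁» gives Theorem 4's «α₀′ + α₁′ ≤ c₁» at `α₁′ = 6dL²Mα₀ + ω` since `L ≤ dM`
  have h134 : (L : ℝ) ^ 3 * α₀ + (6 * d * (L : ℝ) ^ 2 * c.M * α₀ + ω) ≤ 7 * d * (L : ℝ) ^ 2 * c.M * α₀ + ω := by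
    have h0 := (B8.prop6_smallness_iff (d := (d : ℝ)) (M := (c.M : ℝ)) hLpos hα).2 hLdM
    linarith
  -- every window from «7dL²Mα₀ + ω ≤ c₁»
  obtain ⟨⟨hα3, hα2, hsmall⟩, ⟨hα₀c, hα₁c, hα₂c⟩, h61, ⟨-, -, h16, -, hc3α, hsmall₁⟩, h12⟩ := W c.M c.ρ hM1 hρM hM hLdM α₀ hα ω hω hsW
  -- PROPOSITION 6's existence half at the member for `(U₀″)^h` FROM THE REAL FAMILIES + `H59D₁` (F5)
  obtain ⟨u, huG, huS, h129, hLan, h162, hw', h135⟩ := H4 η hη c U₀ hU₀G α₀ hα hα3 hα2 hA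
    hsmall h hhG X hconst ω hω hoscj hosc0 (h134.trans hs₄) w hw REAL H59
  have hu : ∀ x, u x ∈ unitaryUnits 𝔸 := fun x => hGu (huG x)
  -- PROPOSITION 3's norm members at the member for `(U₀″)^h` FROM THE FOUR-LINE FLAT SOCKET (F4)
  obtain ⟨h136g, h139j, h139l⟩ := N3 η hη c SB9 U₀ hU₀ α₀ hα hα3 hα2 hA hsmall h hh X hconst ω hω hoscj hosc0 hα₀c hα₂c
    h61 hsmall₁ u hu huS h129 hLan h162
  -- the three norm members of (1.136), with print's constant for the pre-composed input (`const_136` + `ω`)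
  have hcB : B * ((L : ℝ) ^ 3 * α₀ + (6 * d * (L : ℝ) ^ 2 * c.M * α₀ + ω)) ≤ B * (7 * d * (L : ℝ) ^ 2 * c.M * α₀ + ω) :=
    mul_le_mul_of_nonneg_left h134 hB0.le
  have h136₂ := h136g.trans hcB
  have h136₃ := h139j.trans hcB
  have h136₄ := h139l.trans hcB
  have h16C : 16 * (131072 * ((d : ℝ) + 1) ^ 2 * (KZ d L) ^ 2) * (B * ((L : ℝ) ^ 3 * α₀ + (6 * d * (L : ℝ) ^ 2 * c.M * α₀ + ω))) ≤ 1 := by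
    have e3 : B * (7 * d * (L : ℝ) ^ 2 * c.M * α₀ + ω) ≤ B * (1 / (16 * C * B)) := mul_le_mul_of_nonneg_left hsC hB0.le
    have e4 : B * (1 / (16 * C * B)) = 1 / (16 * C) := by field_simp
    have e5 : B * ((L : ℝ) ^ 3 * α₀ + (6 * d * (L : ℝ) ^ 2 * c.M * α₀ + ω)) ≤ 1 / (16 * C) := by linarith [hcB, e3]
    calc 16 * (131072 * ((d : ℝ) + 1) ^ 2 * (KZ d L) ^ 2) * (B * ((L : ℝ) ^ 3 * α₀ + (6 * d * (L : ℝ) ^ 2 * c.M * α₀ + ω)))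
        ≤ 16 * C * (1 / (16 * C)) := mul_le_mul_of_nonneg_left e5 (by positivity)
      _ = 1 := by field_simp
  have h4C : 4 * (131072 * ((d : ℝ) + 1) ^ 2) * (KZ d L) ^ 2 * (5 * (d : ℝ) * L * B₀ * ((L : ℝ) ^ 3 * α₀ + (6 * d * (L : ℝ) ^ 2 * c.M * α₀ + ω))) ≤ 1 := by
    have h0 : 0 ≤ (131072 * ((d : ℝ) + 1) ^ 2 * (KZ d L) ^ 2) * (B * ((L : ℝ) ^ 3 * α₀ + (6 * d * (L : ℝ) ^ 2 * c.M * α₀ + ω))) := by positivity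
    have e : 4 * (131072 * ((d : ℝ) + 1) ^ 2) * (KZ d L) ^ 2 * (5 * (d : ℝ) * L * B₀ * ((L : ℝ) ^ 3 * α₀ + (6 * d * (L : ℝ) ^ 2 * c.M * α₀ + ω)))
        = 4 * ((131072 * ((d : ℝ) + 1) ^ 2 * (KZ d L) ^ 2) * (B * ((L : ℝ) ^ 3 * α₀ + (6 * d * (L : ℝ) ^ 2 * c.M * α₀ + ω)))) := by rw [hB_def]; ring
    rw [e]; linarith only [h16C, h0]
  exact gaugedBoundB8DZBody_of_clauses_precomposed_mem hd2 hLs hs1 hGu hB₀ hη c U₀ hU₀ hα hA hα3 hα2 hsmall h hhG X hconst hω h4C hc3α u huG huS h129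
    hLan h162 hw' h135 h136₂ h136₃ h136₄

end Real

#print axioms windows136Z_of_small_omega
#print axioms gaugedBoundB8D_dentedMember_precomposed_real_γ_mem

end Literature.MathematicalPhysics.QuantumFieldTheory.Balaban1983to89.B8Prop6DentedCubeMemberGaugedRealGammaGPrecompRec

end
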